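import Literature.NumberTheory.EllipticCurves.MazurTorsionLeafFromStepThreeProofs
import HarnessLib

/-!
# Mazur 1977, Ch. III §5 (no rational point of prime order `N ∉ {2,3,5,7,13}`): decomposition —
# the one remaining printed input, Step 3 at the bad primes `q ≡ ±1 (mod N)`

Topic `Literature/NumberTheory/EllipticCurves`. SPLIT of the named fact
`Literature.NumberTheory.EllipticCurves.Mazur1977_no_prime_torsion W` (`MazurTorsion.lean`;
B. Mazur, *Modular curves and the Eisenstein ideal*, Publ. Math. IHÉS 47 (1977), Ch. III §5,
pp. 156–160: an elliptic curve over `ℚ` has no rational point of prime order `N ∉ {2, 3, 5, 7, 13}`).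
The sibling proof files `MazurTorsion*Proofs.lean` formalise the whole of pp. 156–160 — First and
Second reductions, (5.4), Steps 1, 2 and 4, Step 3 in the range `q + 1 < N` and at `q = N`, the
Third reduction, and Herbrand's theorem at `B₂` with class field theory (`Mazur1977_herbrand`) — and
reduce the fact to ONE printed input (`Mazur1977_no_prime_torsion_of_stepThree`,
`MazurTorsionLeafFromStepThreeProofs.lean`): Mazur's **Step 3**, "`ℤ/N ⊄ (E_{/𝔽_q})⁰`" at the
bad primes `q ≠ N` of the putative curve.  Moreover Step 3 holds without modular curves at every
bad `q ≢ ±1 (mod N)` (`Mazur1977_not_mem_goodReductionSubgroup_of_not_dvd`: a point of order `N`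
on the identity component of a multiplicative fibre forces `N ∣ #Ẽ_ns(𝔽_q) ∣ q² − 1`).  Hence the
decomposition has a single child, the printed Step 3 restricted to where Mazur's global argument
(the map `X₀(N) → J̃` to the Eisenstein quotient, whose Mordell–Weil group `J̃(ℚ)` is finite,
Thm. III.(3.1), and the cusps `0, ∞` over `ℤ[1/2N]`) is actually needed:

* `Mazur1977_stepThree_eisenstein` — for an elliptic curve `E/ℚ` with a rational point `P` of prime
  order `N ∉ {2,3,5,7,13}` and a bad place `v` of residue characteristic `q ≠ N` with
  `N ∣ q² − 1`, the image of `P` in the minimal model at `v` does not lie in `E₀(ℚ_v)` (the points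
  of nonsingular reduction);

and the PROVED assembly `Mazur1977_no_prime_torsion_holds_of` (case split on `N ∣ q² − 1`).
No notion is missing for the STATEMENT (minimal models, `E₀`, places are in the tree:
`Tamagawa.lean`, `MazurTorsionStepFourProofs.lean`); what is missing for its PROOF is the arithmetic
of `X₀(N)` over `ℤ[1/N]` (cusps, `J₀(N)`, the Eisenstein ideal and quotient `J̃` with `J̃(ℚ)`
finite, Thm. III.(3.1), and the specialization argument at the cusps — the heart of Mazur's paper),
absent from Mathlib and the tree.

## References

* B. Mazur, *Modular curves and the Eisenstein ideal*, Publ. Math. IHÉS 47 (1977) 33–186: Ch. III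
  §5, pp. 156–160, Step 3 (p. 159); Ch. III §3, Thm. (3.1) (`J̃(ℚ)` is finite). [Mazur1977]
-/

noncomputable section

open scoped NumberField Pointwise Classical
open Field IsDedekindDomain NumberField

namespace Literature.NumberTheory.EllipticCurves

open Literature.NumberTheory.GaloisRepresentations
open _root_.WeierstrassCurve Rat.HeightOneSpectrum

/-! ## The child (named fact) -/

/-- NAMED FACT (Mazur 1977, Ch. III §5, Step 3, p. 159: "`ℤ/N ⊄ (E_{/𝔽_q})⁰`", at the bad primes
`q ≡ ±1 (mod N)`). Let `E/ℚ` be an elliptic curve with a rational point `P` of prime order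
`N ∉ {2, 3, 5, 7, 13}`, and let `v` be a place of bad reduction of `E` whose residue characteristic
`q` satisfies `q ≠ N` and `N ∣ q² − 1`. Then the image of `P` in (the chosen) minimal Weierstrass
model of `E` at `v` (`E.localMinimalModel v`, through `ℚ ↪ ℚ_v` and the change of variables to the
minimal model) does NOT lie in the subgroup `E₀(ℚ_v)` of points with nonsingular reduction
(`goodReductionSubgroup`), i.e. `P` does not reduce into the identity component `(E_{/𝔽_q})⁰` of
the Néron fibre.  Print (p. 159, Step 3, `q` a bad prime `≠ N`, reduction multiplicative by Step 1):
"`ℤ/N ⊄ (E_{/𝔽_q})⁰`. For, if it were, … the point `x ∈ X₀(N)(ℚ)` determined by `ℤ/N ⊂ E` would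
specialize to the cusp … contradicting" the finiteness of the Mordell–Weil group of the Eisenstein
quotient `J̃` (Thm. III.(3.1)) via the immersion at the cusp.  At bad `q` with `N ∤ q² − 1` the
statement is elementary and proved in the tree (`Mazur1977_not_mem_goodReductionSubgroup_of_not_dvd`);
with `Mazur1977_no_prime_torsion_of_stepThree` this child is all that the tree's proof of
`Mazur1977_no_prime_torsion` still takes as input. Users take `(h : Mazur1977_stepThree_eisenstein)`.
[cite: Mazur1977, Ch. III §5, Step 3 (p. 159), with Ch. III Thm. (3.1)] -/
def Mazur1977_stepThree_eisenstein : Prop :=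
  ∀ (E : WeierstrassCurve ℚ) [E.IsElliptic] (N : ℕ) [Fact N.Prime],
    N ∉ ({2, 3, 5, 7, 13} : Finset ℕ) → ∀ {P : E.toAffine.Point}, addOrderOf P = N →
      ∀ v : HeightOneSpectrum (𝓞 ℚ), ¬ E.HasGoodReductionAt v → (primesEquiv v : ℕ) ≠ N →
        N ∣ (primesEquiv v : ℕ) ^ 2 - 1 →
          VariableChange.pointEquiv (E.baseChange (v.adicCompletion ℚ))
              ((E.baseChange (v.adicCompletion ℚ)).exists_isMinimal
                (v.adicCompletionIntegers ℚ)).choose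
              (Affine.Point.map (W' := E.toAffine) (S := ℚ)
                (Algebra.ofId ℚ (v.adicCompletion ℚ)) P) ∉
            (E.localMinimalModel v).goodReductionSubgroup (v.adicCompletionIntegers ℚ)

/-! ## The assembly (proved) -/

/-- **Mazur's prime-case theorem from Step 3 at the bad primes `q ≡ ±1 (mod N)` (SPLIT
assembly).** `Mazur1977_stepThree_eisenstein → Mazur1977_no_prime_torsion W` for every
Weierstrass curve `W` over `ℚ`: Step 3 at the remaining bad primes `q ≠ N` (`N ≤ q + 1`,
`N ∤ q² − 1`) is `Mazur1977_not_mem_goodReductionSubgroup_of_not_dvd`, and everything else of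
pp. 156–160 is `Mazur1977_no_prime_torsion_of_stepThree`.
[cite: Mazur1977, Ch. III §5, pp. 156–160] -/
theorem Mazur1977_no_prime_torsion_holds_of (h : Mazur1977_stepThree_eisenstein)
    (W : WeierstrassCurve ℚ) : Mazur1977_no_prime_torsion W :=
  Mazur1977_no_prime_torsion_of_stepThree W fun E _ N _ hNS P hP v hv hvN _ => by
    by_cases hq : N ∣ (primesEquiv v : ℕ) ^ 2 - 1
    · exact h E N hNS hP v hv hvN hq
    · exact Mazur1977_not_mem_goodReductionSubgroup_of_not_dvd E Fact.out hNS v hvN hq hv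
        ((addOrderOf_pointEquiv_map_eq E v P).trans hP)

end Literature.NumberTheory.EllipticCurves
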